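import Summits.AtomisticToContinuum.FouriersLaw.Theorems.LocalOhmBVLocalOhmOddPart
import Summits.AtomisticToContinuum.FouriersLaw.Theorems.LocalOhmBVLocalOhmShiftAverage

/-!
# Symmetry reduction for the rigidity stub of the local-Ohm line
(crux `LocalOhmBV.LocalOhm`, item stmt-AtomisticToContinuum-12009, line `registered`/birth; glue for the
rigidity stub — registered as `stub_oddSectorLiouvilleSym` after the reshape of 2026-08-17)

The extraction stub S2 of the line produces, from a violating sequence, a shift-invariant Gibbs state `μ∞` of
`pinnedChain ω₂ lam β γ` and a functional `Λ` on observables of the infinite chain which is (1) linear on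
continuous polynomially bounded cylinder observables, (2) translation-uniformly `L²(μ∞)`-bounded on boxes,
(3) `liouvilleZ`-invariant, and has UNIT current on every bond, `Λ(j_i) = 1`. This file proves that such a
`Λ` cannot exist as soon as the SYMMETRIC form of linearised odd-sector rigidity holds: every functional of the
class (1)–(3) which is moreover SHIFT INVARIANT and ODD under momentum reversal (both on cylinder observables)
kills the current, `Λ(j_0) = 0`. Proof: pass to the odd part (`oddPart_spec`: in the class, odd, same values
on the odd cylinder observables `j_i`), then to its shift average (`exists_shiftAverage`: in the class, shift
invariant, odd, and equal to `1` on `j_0` because all translates `j_k` of `j_0` have value `1`); the symmetric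
rigidity statement gives `0 = 1`. Hence the rigidity input of the line may assume both symmetries for free —
the zero-kinetic-marginal hypothesis of the original stub is idle, and what remains is exactly the route's
foreseen layer-2 statement `OddSectorRigidityLin` (no translation-covariant, odd, regular, invariant
first-order perturbation of the Gibbs state carries current).
-/

set_option autoImplicit false

noncomputable section

namespace Summit.AtomisticToContinuum.FouriersLaw.Theorems.LocalOhmBirth

open MeasureTheory Filter Topology
open scoped BigOperators
open Literature.MathematicalPhysics.KineticTheory
open Literature.MathematicalPhysics.KineticTheory.HeatConduction

/-- **No unit-current functional under symmetric linearised odd-sector rigidity.** If every shift-invariant,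
odd, linear, translation-uniformly `L²(μ∞)`-regular, `liouvilleZ`-invariant functional over a shift-invariant
Gibbs state of `pinnedChain ω₂ lam β γ` (all parameters `> 0`, `T > 0`) has `Λ(j_0) = 0`, then NO linear,
regular, invariant functional has unit current on all bonds. (The composition `LocalOhm_of` of the line feeds
the functional extracted by `stub_blowUpLimit` into this.) -/
theorem not_unitCurrent_of_symmetricRigidity :
    (∀ ω₂ lam β γ : ℝ, 0 < ω₂ → 0 < lam → 0 < β → 0 < γ → ∀ T : ℝ, 0 < T →
      ∀ μinf : Measure ChainConfig, (pinnedChain ω₂ lam β γ).IsChainGibbsMeasure T μinf →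
      IsShiftInvariant μinf →
      ∀ Λ : (ChainConfig → ℝ) → ℝ,
      (∀ (a : ℤ) (n : ℕ) (g : (Fin (n + 1) → ℝ × ℝ) → ℝ), Continuous g →
        (∃ (C₀ : ℝ) (m : ℕ), ∀ y, |g y| ≤ C₀ * (1 + ‖y‖) ^ m) →
        Λ ((g ∘ boxRestrictAt a n) ∘ shift) = Λ (g ∘ boxRestrictAt a n)) →
      (∀ (a : ℤ) (n : ℕ) (g : (Fin (n + 1) → ℝ × ℝ) → ℝ), Continuous g →
        (∃ (C₀ : ℝ) (m : ℕ), ∀ y, |g y| ≤ C₀ * (1 + ‖y‖) ^ m) →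
        Λ ((g ∘ boxRestrictAt a n) ∘ momentumReversalZ) = -Λ (g ∘ boxRestrictAt a n)) →
      (∀ (a : ℤ) (n : ℕ) (c₁ c₂ : ℝ) (g₁ g₂ : (Fin (n + 1) → ℝ × ℝ) → ℝ), Continuous g₁ → Continuous g₂ →
        (∃ (C₀ : ℝ) (m : ℕ), ∀ y, |g₁ y| ≤ C₀ * (1 + ‖y‖) ^ m ∧ |g₂ y| ≤ C₀ * (1 + ‖y‖) ^ m) →
        Λ ((fun y => c₁ * g₁ y + c₂ * g₂ y) ∘ boxRestrictAt a n) =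
          c₁ * Λ (g₁ ∘ boxRestrictAt a n) + c₂ * Λ (g₂ ∘ boxRestrictAt a n)) →
      (∀ n : ℕ, ∃ A : ℝ, ∀ (a : ℤ) (g : (Fin (n + 1) → ℝ × ℝ) → ℝ), Continuous g →
        (∃ (C₀ : ℝ) (m : ℕ), ∀ y, |g y| ≤ C₀ * (1 + ‖y‖) ^ m) →
        |Λ (g ∘ boxRestrictAt a n)| ≤ A * Real.sqrt (∫ σ, (g (boxRestrictAt a n σ)) ^ 2 ∂μinf)) →
      (∀ (a : ℤ) (n : ℕ) (G : (Fin (n + 1) → ℝ × ℝ) → ℝ), ContDiff ℝ 1 G →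
        (∃ (C₀ : ℝ) (m : ℕ), ∀ y, |G y| ≤ C₀ * (1 + ‖y‖) ^ m ∧ ‖fderiv ℝ G y‖ ≤ C₀ * (1 + ‖y‖) ^ m) →
        Λ (liouvilleZ (pinnedChain ω₂ lam β γ) (G ∘ boxRestrictAt a n)) = 0) →
      Λ (fun σ => (pinnedChain ω₂ lam β γ).bondCurrentZ σ 0) = 0) →
    ∀ {ω₂ lam β γ : ℝ}, 0 < ω₂ → 0 < lam → 0 < β → 0 < γ → ∀ {T : ℝ}, 0 < T →
    ∀ {μinf : Measure ChainConfig}, (pinnedChain ω₂ lam β γ).IsChainGibbsMeasure T μinf →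
    IsShiftInvariant μinf → ∀ (Λ : (ChainConfig → ℝ) → ℝ),
    (∀ (a : ℤ) (n : ℕ) (c₁ c₂ : ℝ) (g₁ g₂ : (Fin (n + 1) → ℝ × ℝ) → ℝ), Continuous g₁ →
      Continuous g₂ →
      (∃ (C₀ : ℝ) (m : ℕ), ∀ y, |g₁ y| ≤ C₀ * (1 + ‖y‖) ^ m ∧ |g₂ y| ≤ C₀ * (1 + ‖y‖) ^ m) →
      Λ ((fun y => c₁ * g₁ y + c₂ * g₂ y) ∘ boxRestrictAt a n) =
        c₁ * Λ (g₁ ∘ boxRestrictAt a n) + c₂ * Λ (g₂ ∘ boxRestrictAt a n)) →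
    (∀ n : ℕ, ∃ A : ℝ, ∀ (a : ℤ) (g : (Fin (n + 1) → ℝ × ℝ) → ℝ), Continuous g →
      (∃ (C₀ : ℝ) (m : ℕ), ∀ y, |g y| ≤ C₀ * (1 + ‖y‖) ^ m) →
      |Λ (g ∘ boxRestrictAt a n)| ≤ A * Real.sqrt (∫ σ, (g (boxRestrictAt a n σ)) ^ 2 ∂μinf)) →
    (∀ (a : ℤ) (n : ℕ) (G : (Fin (n + 1) → ℝ × ℝ) → ℝ), ContDiff ℝ 1 G →
      (∃ (C₀ : ℝ) (m : ℕ), ∀ y, |G y| ≤ C₀ * (1 + ‖y‖) ^ m ∧ ‖fderiv ℝ G y‖ ≤ C₀ * (1 + ‖y‖) ^ m) →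
      Λ (liouvilleZ (pinnedChain ω₂ lam β γ) (G ∘ boxRestrictAt a n)) = 0) →
    (∀ i : ℤ, Λ (fun σ => (pinnedChain ω₂ lam β γ).bondCurrentZ σ i) = 1) → False := by
  intro hsym ω₂ lam β γ hω hl hβ hγ T hT μinf hG hS Λ hlin hbd hinv hcur
  -- Step 1: the odd part `Λ⁻` is in the class, odd, and still has unit current on every bond
  obtain ⟨hodd', hlin', hbd', hinv', hfix⟩ := oddPart_spec (pinnedChain ω₂ lam β γ) hG Λ hlin hbd hinv
  set Λ₁ : (ChainConfig → ℝ) → ℝ := fun f => (Λ f - Λ (f ∘ momentumReversalZ)) / 2 with hΛ₁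
  have hcur₁ : ∀ i : ℤ, Λ₁ (fun σ => (pinnedChain ω₂ lam β γ).bondCurrentZ σ i) = 1 := by
    intro i
    have hj := hfix i 1 _ (continuous_bondCurrentWindow β) ⟨2 + 8 * |β|, 4, polyBound_bondCurrentWindow β⟩
      (bondCurrentWindow_boxRev β)
    rw [← bondCurrentZ_pinnedChain_eq_comp_boxRestrictAt ω₂ lam β γ i] at hj
    rw [← hcur i]
    exact hj
  have hodd₁ : ∀ (a : ℤ) (n : ℕ) (g : (Fin (n + 1) → ℝ × ℝ) → ℝ), Continuous g →
      (∃ (C₀ : ℝ) (m : ℕ), ∀ y, |g y| ≤ C₀ * (1 + ‖y‖) ^ m) →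
      Λ₁ ((g ∘ boxRestrictAt a n) ∘ momentumReversalZ) = -Λ₁ (g ∘ boxRestrictAt a n) :=
    fun a n g _ _ => hodd' (g ∘ boxRestrictAt a n)
  -- Step 2: the shift average `Λ̄` of `Λ⁻` is in the class, shift invariant, odd, and `Λ̄(j_0) = 1`
  obtain ⟨Λ₂, hshift₂, hoddOf₂, hlin₂, hbd₂, hinv₂, hconst₂⟩ :=
    exists_shiftAverage (pinnedChain ω₂ lam β γ) hS Λ₁ hlin' hbd' hinv'
  have hodd₂ := hoddOf₂ hodd₁
  have hcur₂ : Λ₂ (fun σ => (pinnedChain ω₂ lam β γ).bondCurrentZ σ 0) = 1 := by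
    refine hconst₂ _ 1 fun k => ?_
    rw [OscillatorChain.bondCurrentZ_comp_chainShift]
    exact hcur₁ k
  -- Step 3: symmetric rigidity says `Λ̄(j_0) = 0`
  have h0 := hsym ω₂ lam β γ hω hl hβ hγ T hT μinf hG hS Λ₂ hshift₂ hodd₂ hlin₂ hbd₂ hinv₂
  rw [h0] at hcur₂
  exact zero_ne_one hcur₂

end Summit.AtomisticToContinuum.FouriersLaw.Theorems.LocalOhmBirth

end
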